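import Literature.NumberTheory.EllipticCurves.CongruenceEisensteinWeightOne
import HarnessLib

/-!
# Hecke's congruence Eisenstein series of weight one: holomorphy and polynomial bounds in `s`

Topic `Literature/NumberTheory/EllipticCurves`; namespace
`Literature.NumberTheory.EllipticCurves.ModularForms`; theorems only (no definition, no named
fact).

For the continuation `congrCont M v₀ z s` of the congruence Eisenstein series
`G(z, s; v₀) = ∑_{v ≡ v₀ (M), v ≠ 0} (cz+d)⁻¹ (y/|cz+d|²)ˢ` (`CongruenceEisensteinWeightOne.lean`:
`yˢ M^{-1-2s}[𝟙 2ζ_odd(d₀/M, 1+2s) - 2i I₂(s) y^{-2s} ζ_odd(c₀/M, 2s) + ∑_u Σ_col(u)]`) we prove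

* `differentiableOn_congrCont` — **`s ↦ congrCont(z, s; v₀)` is holomorphic on `Re s > -1/2`**
  (the odd Hurwitz zeta functions are entire — Mathlib `differentiable_hurwitzZetaOdd`; `I₂` is
  holomorphic there; the column series is dominated on boxes by
  `C ((|c| y/M)^{-2-2a} + (|c| y/M)^{-2-2b})`, `c = c₀ + Mu ≠ 0`, which is summable over `u`);
* `exists_bound_congrCont_box` — **polynomial growth in `y = Im z`, uniformly on boxes in `s`**: for
  `-1/2 < a < b`, `0 < T` there are `C, A ≥ 0` with `‖congrCont(z, s; v₀)‖ ≤ C (y^A + y^{-A})` for all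
  `s` with `a < Re s < b`, `|Im s| < T` and all `z ∈ ℍ` (every compact subset of `Re s > -1/2` lies in
  such a box).

Together with `congrSum_eq_congrCont` these are exactly the two inputs (continuation and
moderate growth at every cusp, uniformly in `s`) that the Rankin–Selberg unfolding with a weight-one
Eisenstein series needs (Hecke 1927, §2; Shimura 1976, §2).

## References

* E. Hecke, *Theorie der Eisensteinschen Reihen höherer Stufe…*, Abh. Math. Sem. Hamburg 5 (1927),
  §2.
* G. Shimura, *The special values of the zeta functions associated with cusp forms*, Comm. Pure
  Appl. Math. 29 (1976), §2.
-/

noncomputable section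

open Complex Real Set MeasureTheory Filter Finset HurwitzZeta Metric Bornology
open scoped Topology UpperHalfPlane

namespace Literature.NumberTheory.EllipticCurves.ModularForms

/-! ### Powers of `y`: elementary inequalities -/

/-- `y^e ≤ y^A + y^{-A}` for `y > 0` and `|e| ≤ A`. [folklore] -/
theorem rpow_le_rpow_add_rpow_neg {y : ℝ} (hy : 0 < y) {e A : ℝ} (h : |e| ≤ A) :
    y ^ e ≤ y ^ A + y ^ (-A) := by
  rcases le_or_gt 1 y with h1 | h1
  · have : y ^ e ≤ y ^ A := Real.rpow_le_rpow_of_exponent_le h1 ((le_abs_self e).trans h)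
    linarith [Real.rpow_nonneg hy.le (-A)]
  · have : y ^ e ≤ y ^ (-A) :=
      Real.rpow_le_rpow_of_exponent_ge hy h1.le (by linarith [neg_abs_le e])
    linarith [Real.rpow_nonneg hy.le A]

/-- Products of such bounds: `(y^A + y^{-A})(y^B + y^{-B}) ≤ 4 (y^{A+B} + y^{-(A+B)})`
(`A, B ≥ 0`). [folklore] -/
theorem rpow_add_mul_rpow_add_le {y : ℝ} (hy : 0 < y) {A B : ℝ} (hA : 0 ≤ A) (hB : 0 ≤ B) :
    (y ^ A + y ^ (-A)) * (y ^ B + y ^ (-B)) ≤ 4 * (y ^ (A + B) + y ^ (-(A + B))) := by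
  have h1 : y ^ A * y ^ B ≤ y ^ (A + B) + y ^ (-(A + B)) := by
    rw [← Real.rpow_add hy]
    exact rpow_le_rpow_add_rpow_neg hy (by rw [abs_of_nonneg (by positivity)])
  have h2 : y ^ A * y ^ (-B) ≤ y ^ (A + B) + y ^ (-(A + B)) := by
    rw [← Real.rpow_add hy]
    exact rpow_le_rpow_add_rpow_neg hy (abs_le.mpr ⟨by linarith, by linarith⟩)
  have h3 : y ^ (-A) * y ^ B ≤ y ^ (A + B) + y ^ (-(A + B)) := by
    rw [← Real.rpow_add hy]
    exact rpow_le_rpow_add_rpow_neg hy (abs_le.mpr ⟨by linarith, by linarith⟩)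
  have h4 : y ^ (-A) * y ^ (-B) ≤ y ^ (A + B) + y ^ (-(A + B)) := by
    rw [← Real.rpow_add hy]
    exact rpow_le_rpow_add_rpow_neg hy (by rw [show -A + -B = -(A + B) by ring, abs_neg,
      abs_of_nonneg (by positivity)])
  nlinarith

/-- `y^σ ≤ y^a + y^b` for `a < σ < b`, `y > 0`. [folklore] -/
theorem rpow_between_le {y a b σ : ℝ} (hy : 0 < y) (ha : a < σ) (hb : σ < b) :
    y ^ σ ≤ y ^ a + y ^ b := by
  rcases le_or_gt 1 y with h1 | h1
  · have : y ^ σ ≤ y ^ b := Real.rpow_le_rpow_of_exponent_le h1 hb.le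
    linarith [Real.rpow_nonneg hy.le a]
  · have : y ^ σ ≤ y ^ a := Real.rpow_le_rpow_of_exponent_ge hy h1.le ha.le
    linarith [Real.rpow_nonneg hy.le b]

/-- The closed box `a ≤ Re s ≤ b`, `|Im s| ≤ T` is compact. [folklore] -/
theorem isCompact_closedBox (a b T : ℝ) :
    IsCompact {s : ℂ | a ≤ s.re ∧ s.re ≤ b ∧ |s.im| ≤ T} := by
  refine isCompact_of_isClosed_isBounded ?_ ?_
  · exact (isClosed_le continuous_const Complex.continuous_re).inter
      ((isClosed_le Complex.continuous_re continuous_const).inter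
        (isClosed_le (continuous_abs.comp Complex.continuous_im) continuous_const))
  · rw [isBounded_iff_forall_norm_le]
    refine ⟨|a| + |b| + |T|, fun s hs ↦ ?_⟩
    obtain ⟨h1, h2, h3⟩ := hs
    calc ‖s‖ ≤ |s.re| + |s.im| := Complex.norm_le_abs_re_add_abs_im s
      _ ≤ (|a| + |b|) + |T| := by
          refine add_le_add ?_ (h3.trans (le_abs_self T))
          rcases le_or_gt 0 s.re with h | h
          · rw [abs_of_nonneg h]; linarith [le_abs_self b, abs_nonneg a]
          · rw [abs_of_neg h]; linarith [neg_le_abs a, abs_nonneg b]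

/-! ### Holomorphy of the column series -/

section Columns

variable {M : ℕ} (hM : 0 < M) (v₀ : Fin 2 → ℤ) (z : ℍ)
include hM

/-- Each column term is holomorphic on `Re s > -1`. [folklore] -/
theorem differentiableAt_congrColumn {s : ℂ} (hs : -1 < s.re) (u : ℤ) :
    DifferentiableAt ℂ (fun s : ℂ ↦ congrColumn M v₀ z s u) s := by
  have hM' : (0 : ℝ) < M := by exact_mod_cast hM
  have hopen : {s : ℂ | -1 < s.re} ∈ 𝓝 s :=
    (isOpen_lt continuous_const Complex.continuous_re).mem_nhds hs
  rcases lt_trichotomy (v₀ 0 + M * u) 0 with hneg | hzero | hpos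
  · have hw : 0 < (((((-(v₀ 0 + M * u) : ℤ)) : ℂ) * z + ((-(v₀ 1) : ℤ) : ℂ)) / M).im := by
      rw [im_rowBase z]
      exact div_pos (mul_pos (by exact_mod_cast (by linarith : 0 < -(v₀ 0 + M * u)))
        z.im_pos) hM'
    have h := ((differentiableOn_tsum_scaled_rowCont hw).differentiableAt hopen).neg
    refine h.congr_of_eventuallyEq (Eventually.of_forall fun t ↦ ?_)
    simp only [congrColumn, if_neg (not_lt.mpr hneg.le), if_pos hneg, fullRowSeries, Pi.neg_apply]
  · refine (differentiableAt_const (0 : ℂ)).congr_of_eventuallyEq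
      (Eventually.of_forall fun t ↦ ?_)
    simp only [congrColumn, if_neg (not_lt.mpr hzero.le), if_neg (not_lt.mpr hzero.ge)]
  · have hw : 0 < ((((((v₀ 0 + M * u) : ℤ)) : ℂ) * z + ((v₀ 1 : ℤ) : ℂ)) / M).im := by
      rw [im_rowBase z]
      exact div_pos (mul_pos (by exact_mod_cast hpos) z.im_pos) hM'
    have h := (differentiableOn_tsum_scaled_rowCont hw).differentiableAt hopen
    refine h.congr_of_eventuallyEq (Eventually.of_forall fun t ↦ ?_)
    simp only [congrColumn, if_pos hpos, fullRowSeries]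

/-- The two-exponent form of the column bound on a box `a < Re s < b`, `|Im s| < T`:
`‖Σ_col(u)‖ ≤ K_box · 𝟙[c ≠ 0] ((|c| y/M)^{-2-2a} + (|c| y/M)^{-2-2b})`. [folklore] -/
theorem norm_congrColumn_le_box {a b T : ℝ} (ha : -1 < a) {s : ℂ} (hsa : a < s.re)
    (hsb : s.re < b) (hsT : |s.im| < T) (u : ℤ) :
    ‖congrColumn M v₀ z s u‖ ≤ 160 * (1 + (|a| + |b| + T)) ^ 2 * Real.exp (2 * π * T) *
      (∫ v : ℝ, (1 + v ^ 2) ^ (-(3 + 2 * a) / 2)) * (1 / 3) *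
        (if v₀ 0 + M * u = 0 then 0 else
          (|((v₀ 0 + M * u : ℤ) : ℝ)| * z.im / M) ^ (-2 - 2 * a) +
          (|((v₀ 0 + M * u : ℤ) : ℝ)| * z.im / M) ^ (-2 - 2 * b)) := by
  have hM' : (0 : ℝ) < M := by exact_mod_cast hM
  have hs1 : -1 < s.re := by linarith
  refine (norm_congrColumn_le hM v₀ z hs1 u).trans ?_
  have hsn : ‖s‖ ≤ |a| + |b| + T := by
    calc ‖s‖ ≤ |s.re| + |s.im| := Complex.norm_le_abs_re_add_abs_im s
      _ ≤ (|a| + |b|) + T := by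
          refine add_le_add ?_ hsT.le
          rcases le_or_gt 0 s.re with h | h
          · rw [abs_of_nonneg h]; linarith [le_abs_self b, abs_nonneg a]
          · rw [abs_of_neg h]; linarith [neg_le_abs a, abs_nonneg b]
  have hexp : Real.exp (2 * π * |s.im|) ≤ Real.exp (2 * π * T) :=
    Real.exp_le_exp.mpr (by nlinarith [Real.pi_pos, hsT.le])
  have hIs : ∫ v : ℝ, (1 + v ^ 2) ^ (-(3 + 2 * s.re) / 2) ≤
      ∫ v : ℝ, (1 + v ^ 2) ^ (-(3 + 2 * a) / 2) :=
    integral_one_add_sq_rpow_antitone (by linarith) (by linarith)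
  have hIs0 : 0 ≤ ∫ v : ℝ, (1 + v ^ 2) ^ (-(3 + 2 * s.re) / 2) :=
    integral_nonneg fun v ↦ Real.rpow_nonneg (by positivity) _
  have hind : (if v₀ 0 + M * u = 0 then (0 : ℝ) else
      (|((v₀ 0 + M * u : ℤ) : ℝ)| * z.im / M) ^ (-2 - 2 * s.re)) ≤
      (if v₀ 0 + M * u = 0 then 0 else
        (|((v₀ 0 + M * u : ℤ) : ℝ)| * z.im / M) ^ (-2 - 2 * a) +
        (|((v₀ 0 + M * u : ℤ) : ℝ)| * z.im / M) ^ (-2 - 2 * b)) := by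
    split_ifs with h0
    · exact le_rfl
    · have hη : 0 < |((v₀ 0 + M * u : ℤ) : ℝ)| * z.im / M :=
        div_pos (mul_pos (abs_pos.mpr (by exact_mod_cast h0)) z.im_pos) hM'
      exact rpow_neg_two_sub_le hη hsa hsb
  have hind0 : 0 ≤ (if v₀ 0 + M * u = 0 then (0 : ℝ) else
      (|((v₀ 0 + M * u : ℤ) : ℝ)| * z.im / M) ^ (-2 - 2 * s.re)) := by
    split_ifs
    · exact le_rfl
    · exact Real.rpow_nonneg (by positivity) _
  refine mul_le_mul ?_ hind hind0 (by positivity)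
  refine mul_le_mul_of_nonneg_right ?_ (by norm_num)
  refine mul_le_mul ?_ hIs hIs0 (by positivity)
  refine mul_le_mul ?_ hexp (by positivity) (by positivity)
  nlinarith [norm_nonneg s, hsn]

/-- The box majorant is summable over `u` (`-1/2 < a < b`). [folklore] -/
theorem summable_box_majorant {a b : ℝ} (ha : -1 / 2 < a) (hab : a < b) (C : ℝ) :
    Summable fun u : ℤ ↦ C * (if v₀ 0 + M * u = 0 then (0 : ℝ) else
      (|((v₀ 0 + M * u : ℤ) : ℝ)| * z.im / M) ^ (-2 - 2 * a) +
      (|((v₀ 0 + M * u : ℤ) : ℝ)| * z.im / M) ^ (-2 - 2 * b)) := by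
  have hM' : (0 : ℝ) < M := by exact_mod_cast hM
  have hy : 0 < z.im / M := div_pos z.im_pos hM'
  have key : ∀ p : ℝ, 1 < 2 + 2 * p → Summable fun u : ℤ ↦ (if v₀ 0 + M * u = 0 then (0 : ℝ) else
      (|((v₀ 0 + M * u : ℤ) : ℝ)| * z.im / M) ^ (-2 - 2 * p)) := by
    intro p hp
    have h := (summable_abs_class_rpow_neg hM v₀ (p := 2 + 2 * p) hp).mul_left
      ((z.im / M) ^ (-2 - 2 * p))
    refine h.congr fun u ↦ ?_
    split_ifs with h0
    · simp
    · have habs : 0 < |((v₀ 0 + M * u : ℤ) : ℝ)| := abs_pos.mpr (by exact_mod_cast h0)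
      rw [show |((v₀ 0 + M * u : ℤ) : ℝ)| * z.im / M = |((v₀ 0 + M * u : ℤ) : ℝ)| * (z.im / M)
          by ring, Real.mul_rpow habs.le hy.le, show -(2 + 2 * p) = -2 - 2 * p by ring]
      ring
  refine Summable.mul_left C (((key a (by linarith)).add (key b (by linarith))).congr fun u ↦ ?_)
  split_ifs <;> simp

/-- **The column series is holomorphic on boxes** `a < Re s < b`, `|Im s| < T`, `-1/2 < a`. [folklore] -/
theorem differentiableOn_tsum_congrColumn_box {a b T : ℝ} (ha : -1 / 2 < a) (hab : a < b) :
    DifferentiableOn ℂ (fun s : ℂ ↦ ∑' u : ℤ, congrColumn M v₀ z s u)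
      {s : ℂ | a < s.re ∧ s.re < b ∧ |s.im| < T} := by
  have hUo : IsOpen {s : ℂ | a < s.re ∧ s.re < b ∧ |s.im| < T} :=
    (isOpen_lt continuous_const Complex.continuous_re).inter
      ((isOpen_lt Complex.continuous_re continuous_const).inter
        (isOpen_lt (continuous_abs.comp Complex.continuous_im) continuous_const))
  refine differentiableOn_tsum_of_summable_norm (summable_box_majorant hM v₀ z ha hab _)
    (fun u ↦ ?_) hUo (fun u s hs ↦ norm_congrColumn_le_box hM v₀ z (by linarith) hs.1 hs.2.1 hs.2.2 u)
  intro s hs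
  exact (differentiableAt_congrColumn hM v₀ z
    (by simp only [Set.mem_setOf_eq] at hs; linarith [hs.1]) u).differentiableWithinAt

/-- **The column series is holomorphic on `Re s > -1/2`.** [folklore] -/
theorem differentiableOn_tsum_congrColumn :
    DifferentiableOn ℂ (fun s : ℂ ↦ ∑' u : ℤ, congrColumn M v₀ z s u) {s : ℂ | -1 / 2 < s.re} := by
  intro s₀ hs₀
  simp only [Set.mem_setOf_eq] at hs₀
  set a : ℝ := (-1 / 2 + s₀.re) / 2 with ha
  set b : ℝ := s₀.re + 1 with hb
  set T : ℝ := |s₀.im| + 1 with hT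
  have ha' : -1 / 2 < a := by rw [ha]; linarith
  have hab : a < b := by rw [ha, hb]; linarith
  have hmem : s₀ ∈ {s : ℂ | a < s.re ∧ s.re < b ∧ |s.im| < T} :=
    ⟨by rw [ha]; linarith, by rw [hb]; linarith, by rw [hT]; linarith⟩
  have hUo : IsOpen {s : ℂ | a < s.re ∧ s.re < b ∧ |s.im| < T} :=
    (isOpen_lt continuous_const Complex.continuous_re).inter
      ((isOpen_lt Complex.continuous_re continuous_const).inter
        (isOpen_lt (continuous_abs.comp Complex.continuous_im) continuous_const))
  exact ((differentiableOn_tsum_congrColumn_box hM v₀ z (T := T) ha' hab).differentiableAt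
    (hUo.mem_nhds hmem)).differentiableWithinAt

/-- **`s ↦ congrCont(z, s; v₀)` is holomorphic on `Re s > -1/2`.** [folklore] -/
theorem differentiableOn_congrCont :
    DifferentiableOn ℂ (congrCont M v₀ z) {s : ℂ | -1 / 2 < s.re} := by
  have hM0 : (M : ℂ) ≠ 0 := by exact_mod_cast hM.ne'
  have hy0 : ((z.im : ℝ) : ℂ) ≠ 0 := by exact_mod_cast z.im_pos.ne'
  intro s hs
  simp only [Set.mem_setOf_eq] at hs
  have h1 : DifferentiableAt ℂ (fun s : ℂ ↦ ((z.im : ℝ) : ℂ) ^ s * (M : ℂ) ^ (-1 - 2 * s)) s :=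
    (differentiableAt_id.const_cpow (Or.inl hy0)).mul
      (((differentiableAt_const _).sub (differentiableAt_id.const_mul _)).const_cpow (Or.inl hM0))
  have hZ : DifferentiableAt ℂ (fun s : ℂ ↦ (if (M : ℤ) ∣ v₀ 0 then
      2 * hurwitzZetaOdd (((v₀ 1 : ℝ) / (M : ℝ) : ℝ) : UnitAddCircle) (1 + 2 * s) else 0)) s := by
    by_cases hd : (M : ℤ) ∣ v₀ 0
    · simp only [if_pos hd]
      exact (differentiableAt_const _).mul (((differentiable_hurwitzZetaOdd _).comp
        ((differentiable_const _).add (differentiable_id.const_mul _))) s)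
    · simp only [if_neg hd]
      exact differentiableAt_const _
  have hA : DifferentiableAt ℂ (fun s : ℂ ↦ 2 * (-I * constIntegral s) * ((z.im : ℝ) : ℂ) ^ (-2 * s) *
      hurwitzZetaOdd (((v₀ 0 : ℝ) / (M : ℝ) : ℝ) : UnitAddCircle) (2 * s)) s := by
    refine (((differentiableAt_const _).mul ((differentiableAt_const _).mul
      (differentiableAt_constIntegral hs))).mul
        ((differentiableAt_id.const_mul (-2 : ℂ)).const_cpow (Or.inl hy0))).mul ?_
    exact ((differentiable_hurwitzZetaOdd _).comp (differentiable_id.const_mul _)) s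
  have hC : DifferentiableAt ℂ (fun s : ℂ ↦ ∑' u : ℤ, congrColumn M v₀ z s u) s :=
    (differentiableOn_tsum_congrColumn hM v₀ z).differentiableAt
      ((isOpen_lt continuous_const Complex.continuous_re).mem_nhds hs)
  exact (h1.mul ((hZ.add hA).add hC)).differentiableWithinAt

end Columns

/-! ### Polynomial bounds in `y`, uniform on boxes in `s` -/

section Bounds

variable {M : ℕ} (hM : 0 < M) (v₀ : Fin 2 → ℤ)
include hM

/-- **The norm of the column series** on a box: `‖∑_u Σ_col(u)‖ ≤ K_box [(y/M)^{-2-2a} S_a +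
(y/M)^{-2-2b} S_b]` with `S_p = ∑_{c ≠ 0} |c|^{-(2+2p)}`. [folklore] -/
theorem norm_tsum_congrColumn_le_box (z : ℍ) {a b T : ℝ} (ha : -1 / 2 < a) (hab : a < b) {s : ℂ}
    (hsa : a < s.re) (hsb : s.re < b) (hsT : |s.im| < T) :
    ‖∑' u : ℤ, congrColumn M v₀ z s u‖ ≤
      160 * (1 + (|a| + |b| + T)) ^ 2 * Real.exp (2 * π * T) *
        (∫ v : ℝ, (1 + v ^ 2) ^ (-(3 + 2 * a) / 2)) * (1 / 3) *
      ((z.im / M) ^ (-2 - 2 * a) * ∑' u : ℤ, (if v₀ 0 + M * u = 0 then (0 : ℝ) else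
          |((v₀ 0 + M * u : ℤ) : ℝ)| ^ (-(2 + 2 * a))) +
        (z.im / M) ^ (-2 - 2 * b) * ∑' u : ℤ, (if v₀ 0 + M * u = 0 then (0 : ℝ) else
          |((v₀ 0 + M * u : ℤ) : ℝ)| ^ (-(2 + 2 * b)))) := by
  have hM' : (0 : ℝ) < M := by exact_mod_cast hM
  have hy : 0 < z.im / M := div_pos z.im_pos hM'
  have hsum := summable_box_majorant hM v₀ z ha hab (160 * (1 + (|a| + |b| + T)) ^ 2 *
    Real.exp (2 * π * T) * (∫ v : ℝ, (1 + v ^ 2) ^ (-(3 + 2 * a) / 2)) * (1 / 3))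
  have h := tsum_of_norm_bounded hsum.hasSum
    (fun u ↦ norm_congrColumn_le_box hM v₀ z (by linarith) hsa hsb hsT u)
  refine h.trans (le_of_eq ?_)
  rw [tsum_mul_left]
  congr 1
  -- split the majorant series
  have key : ∀ p : ℝ, 1 < 2 + 2 * p → HasSum (fun u : ℤ ↦ (if v₀ 0 + M * u = 0 then (0 : ℝ) else
      (|((v₀ 0 + M * u : ℤ) : ℝ)| * z.im / M) ^ (-2 - 2 * p)))
      ((z.im / M) ^ (-2 - 2 * p) * ∑' u : ℤ, (if v₀ 0 + M * u = 0 then (0 : ℝ) else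
          |((v₀ 0 + M * u : ℤ) : ℝ)| ^ (-(2 + 2 * p)))) := by
    intro p hp
    have h := ((summable_abs_class_rpow_neg hM v₀ (p := 2 + 2 * p) hp).hasSum).mul_left
      ((z.im / M) ^ (-2 - 2 * p))
    refine h.congr_fun fun u ↦ ?_
    split_ifs with h0
    · simp
    · have habs : 0 < |((v₀ 0 + M * u : ℤ) : ℝ)| := abs_pos.mpr (by exact_mod_cast h0)
      rw [show |((v₀ 0 + M * u : ℤ) : ℝ)| * z.im / M = |((v₀ 0 + M * u : ℤ) : ℝ)| * (z.im / M)
          by ring, Real.mul_rpow habs.le hy.le, show -(2 + 2 * p) = -2 - 2 * p by ring]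
      ring
  have hab' := ((key a (by linarith)).add (key b (by linarith)))
  exact (hab'.congr_fun fun u ↦ by split_ifs <;> simp).tsum_eq

set_option maxHeartbeats 800000 in
/-- **Polynomial growth in `y`, uniformly on boxes in `s`**: for `-1/2 < a < b`, `0 < T` there are
`C, A ≥ 0` with `‖congrCont(z, s; v₀)‖ ≤ C (y^A + y^{-A})` whenever `a < Re s < b`, `|Im s| < T`.
[folklore] -/
theorem exists_bound_congrCont_box {a b T : ℝ} (ha : -1 / 2 < a) (hab : a < b) (hT : 0 < T) :
    ∃ C A : ℝ, 0 ≤ C ∧ 0 ≤ A ∧ ∀ s : ℂ, a < s.re → s.re < b → |s.im| < T → ∀ z : ℍ,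
      ‖congrCont M v₀ z s‖ ≤ C * (z.im ^ A + z.im ^ (-A)) := by
  have hM' : (0 : ℝ) < M := by exact_mod_cast hM
  have hM1 : (1 : ℝ) ≤ M := by exact_mod_cast hM
  -- compact closed box and the two Hurwitz suprema
  set Kc : Set ℂ := {s : ℂ | a ≤ s.re ∧ s.re ≤ b ∧ |s.im| ≤ T} with hKc
  have hKc : IsCompact Kc := isCompact_closedBox a b T
  have hζ1 : ContinuousOn (fun s : ℂ ↦ hurwitzZetaOdd (((v₀ 1 : ℝ) / (M : ℝ) : ℝ) : UnitAddCircle)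
      (1 + 2 * s)) Kc :=
    ((differentiable_hurwitzZetaOdd _).comp ((differentiable_const _).add
      (differentiable_id.const_mul _))).continuous.continuousOn
  have hζ2 : ContinuousOn (fun s : ℂ ↦ hurwitzZetaOdd (((v₀ 0 : ℝ) / (M : ℝ) : ℝ) : UnitAddCircle)
      (2 * s)) Kc :=
    ((differentiable_hurwitzZetaOdd _).comp (differentiable_id.const_mul _)).continuous.continuousOn
  obtain ⟨Z₁, hZ₁⟩ := hKc.exists_bound_of_continuousOn hζ1
  obtain ⟨Z₂, hZ₂⟩ := hKc.exists_bound_of_continuousOn hζ2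
  have hZ₁0 : 0 ≤ Z₁ := by
    have hmem : ((a : ℂ)) ∈ Kc := by
      refine ⟨by simp, by simp; linarith, by simp; linarith⟩
    exact (norm_nonneg _).trans (hZ₁ _ hmem)
  have hZ₂0 : 0 ≤ Z₂ := by
    have hmem : ((a : ℂ)) ∈ Kc := by
      refine ⟨by simp, by simp; linarith, by simp; linarith⟩
    exact (norm_nonneg _).trans (hZ₂ _ hmem)
  -- the constant-term integral on the box
  set I₂ : ℝ := ∫ u : ℝ, (1 + u ^ 2) ^ (-1 - a) with hI₂
  have hI₂0 : 0 ≤ I₂ := integral_nonneg fun u ↦ Real.rpow_nonneg (by positivity) _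
  have hI₂int : Integrable fun u : ℝ ↦ (1 + u ^ 2) ^ (-1 - a) := by
    have := integrable_one_add_sq_rpow (a := 2 + 2 * a) (by linarith)
    refine this.congr (Eventually.of_forall fun u ↦ ?_)
    simp only
    congr 1; ring
  have hI₂s : ∀ s : ℂ, a < s.re → ‖constIntegral s‖ ≤ I₂ := by
    intro s hsa
    refine (norm_constIntegral_le s).trans (integral_mono_of_nonneg
      (Eventually.of_forall fun u ↦ Real.rpow_nonneg (by positivity) _) hI₂int
      (Eventually.of_forall fun u ↦ ?_))
    exact Real.rpow_le_rpow_of_exponent_le (by nlinarith [sq_nonneg u]) (by linarith)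
  -- the column constants
  set Kb : ℝ := 160 * (1 + (|a| + |b| + T)) ^ 2 * Real.exp (2 * π * T) *
    (∫ v : ℝ, (1 + v ^ 2) ^ (-(3 + 2 * a) / 2)) * (1 / 3) with hKb
  have hKb0 : 0 ≤ Kb := by
    have : 0 ≤ ∫ v : ℝ, (1 + v ^ 2) ^ (-(3 + 2 * a) / 2) :=
      integral_nonneg fun v ↦ Real.rpow_nonneg (by positivity) _
    positivity
  set Sa : ℝ := ∑' u : ℤ, (if v₀ 0 + M * u = 0 then (0 : ℝ) else
      |((v₀ 0 + M * u : ℤ) : ℝ)| ^ (-(2 + 2 * a))) with hSa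
  set Sb : ℝ := ∑' u : ℤ, (if v₀ 0 + M * u = 0 then (0 : ℝ) else
      |((v₀ 0 + M * u : ℤ) : ℝ)| ^ (-(2 + 2 * b))) with hSb
  have hSa0 : 0 ≤ Sa := tsum_nonneg fun u ↦ by
    split_ifs
    · exact le_rfl
    · exact Real.rpow_nonneg (abs_nonneg _) _
  have hSb0 : 0 ≤ Sb := tsum_nonneg fun u ↦ by
    split_ifs
    · exact le_rfl
    · exact Real.rpow_nonneg (abs_nonneg _) _
  -- exponents
  set A₁ : ℝ := |a| + |b| with hA₁
  set A₂ : ℝ := 2 * |a| + 2 * |b| + 2 with hA₂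
  have hA₁0 : 0 ≤ A₁ := by positivity
  have hA₂0 : 0 ≤ A₂ := by positivity
  -- the constant in front of the bracket
  set C₂ : ℝ := 2 * Z₁ + 2 * I₂ * Z₂ * 2 +
    Kb * ((M : ℝ) ^ (2 + 2 * a) * Sa + (M : ℝ) ^ (2 + 2 * b) * Sb) with hC₂
  have hC₂0 : 0 ≤ C₂ := by positivity
  refine ⟨(M : ℝ) ^ (-1 - 2 * a) * C₂ * 4, A₁ + A₂, by positivity, by positivity, ?_⟩
  intro s hsa hsb hsT z
  have hy : 0 < z.im := z.im_pos
  have hsK : s ∈ Kc := ⟨hsa.le, hsb.le, hsT.le⟩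
  -- norms of the three factors
  have hn1 : ‖((z.im : ℝ) : ℂ) ^ s‖ = z.im ^ s.re := Complex.norm_cpow_eq_rpow_re_of_pos hy s
  have hn2 : ‖(M : ℂ) ^ (-1 - 2 * s)‖ ≤ (M : ℝ) ^ (-1 - 2 * a) := by
    rw [Complex.norm_natCast_cpow_of_pos hM]
    simp only [Complex.sub_re, Complex.neg_re, Complex.one_re, Complex.mul_re, Complex.re_ofNat,
      Complex.im_ofNat, zero_mul, sub_zero]
    exact Real.rpow_le_rpow_of_exponent_le hM1 (by linarith)
  -- the bracket
  have hZn : ‖(if (M : ℤ) ∣ v₀ 0 then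
      2 * hurwitzZetaOdd (((v₀ 1 : ℝ) / (M : ℝ) : ℝ) : UnitAddCircle) (1 + 2 * s) else 0)‖ ≤
      2 * Z₁ := by
    split_ifs
    · rw [norm_mul, Complex.norm_ofNat]
      exact mul_le_mul_of_nonneg_left (hZ₁ s hsK) (by norm_num)
    · rw [norm_zero]; positivity
  have hy2 : z.im ^ (-2 * s.re) ≤ z.im ^ (-2 * a) + z.im ^ (-2 * b) := by
    have := rpow_between_le hy (a := -2 * b) (b := -2 * a) (σ := -2 * s.re) (by linarith)
      (by linarith)
    linarith
  have hAn : ‖2 * (-I * constIntegral s) * ((z.im : ℝ) : ℂ) ^ (-2 * s) *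
      hurwitzZetaOdd (((v₀ 0 : ℝ) / (M : ℝ) : ℝ) : UnitAddCircle) (2 * s)‖ ≤
      2 * I₂ * Z₂ * (z.im ^ (-2 * a) + z.im ^ (-2 * b)) := by
    rw [norm_mul, norm_mul, norm_mul, norm_mul, norm_neg, Complex.norm_I, one_mul,
      Complex.norm_ofNat, Complex.norm_cpow_eq_rpow_re_of_pos hy,
      show ((-2 : ℂ) * s).re = -2 * s.re by simp [Complex.mul_re]]
    have h1 := hI₂s s hsa
    have h2 := hZ₂ s hsK
    have h3 : 0 ≤ z.im ^ (-2 * s.re) := Real.rpow_nonneg hy.le _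
    have h4 : 2 * ‖constIntegral s‖ * z.im ^ (-2 * s.re) *
        ‖hurwitzZetaOdd (((v₀ 0 : ℝ) / (M : ℝ) : ℝ) : UnitAddCircle) (2 * s)‖ ≤
        2 * I₂ * z.im ^ (-2 * s.re) * Z₂ :=
      mul_le_mul (mul_le_mul_of_nonneg_right (by linarith) h3) h2 (norm_nonneg _) (by positivity)
    have h5 : 2 * I₂ * z.im ^ (-2 * s.re) * Z₂ ≤ 2 * I₂ * Z₂ * (z.im ^ (-2 * a) + z.im ^ (-2 * b)) := by
      have := mul_le_mul_of_nonneg_left hy2 (show 0 ≤ 2 * I₂ * Z₂ by positivity)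
      linarith
    exact h4.trans h5
  have hdiv : ∀ e : ℝ, (z.im / M) ^ e = (M : ℝ) ^ (-e) * z.im ^ e := fun e ↦ by
    rw [Real.div_rpow hy.le hM'.le, Real.rpow_neg hM'.le, div_eq_mul_inv, mul_comm]
  have hCn : ‖∑' u : ℤ, congrColumn M v₀ z s u‖ ≤
      Kb * ((M : ℝ) ^ (2 + 2 * a) * Sa * z.im ^ (-2 - 2 * a) +
        (M : ℝ) ^ (2 + 2 * b) * Sb * z.im ^ (-2 - 2 * b)) := by
    refine (norm_tsum_congrColumn_le_box hM v₀ z ha hab hsa hsb hsT).trans (le_of_eq ?_)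
    rw [← hKb, ← hSa, ← hSb, hdiv (-2 - 2 * a), hdiv (-2 - 2 * b),
      show -(-2 - 2 * a) = 2 + 2 * a by ring, show -(-2 - 2 * b) = 2 + 2 * b by ring]
    ring
  -- powers of `y` against `P₂ = y^{A₂} + y^{-A₂}`
  have hP : ∀ e : ℝ, |e| ≤ A₂ → z.im ^ e ≤ z.im ^ A₂ + z.im ^ (-A₂) := fun e he ↦
    rpow_le_rpow_add_rpow_neg hy he
  set P₂ : ℝ := z.im ^ A₂ + z.im ^ (-A₂) with hP₂
  have hP₂1 : 1 ≤ P₂ := by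
    have := hP 0 (by rw [abs_zero]; exact hA₂0)
    rwa [Real.rpow_zero] at this
  have hP₂0 : 0 ≤ P₂ := by linarith
  have he1 : z.im ^ (-2 * a) ≤ P₂ := hP _ (by
    rw [abs_mul, abs_neg, abs_two, hA₂]; linarith [abs_nonneg b])
  have he2 : z.im ^ (-2 * b) ≤ P₂ := hP _ (by
    rw [abs_mul, abs_neg, abs_two, hA₂]; linarith [abs_nonneg a])
  have he3 : z.im ^ (-2 - 2 * a) ≤ P₂ := hP _ (abs_le.mpr ⟨by
    rw [hA₂]; linarith [abs_nonneg b, le_abs_self a], by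
    rw [hA₂]; linarith [abs_nonneg b, neg_le_abs a]⟩)
  have he4 : z.im ^ (-2 - 2 * b) ≤ P₂ := hP _ (abs_le.mpr ⟨by
    rw [hA₂]; linarith [abs_nonneg a, le_abs_self b], by
    rw [hA₂]; linarith [abs_nonneg a, neg_le_abs b]⟩)
  -- the bracket `‖Z‖ + ‖A‖ + ‖C‖ ≤ C₂ P₂`
  have hbracket : ‖(if (M : ℤ) ∣ v₀ 0 then
        2 * hurwitzZetaOdd (((v₀ 1 : ℝ) / (M : ℝ) : ℝ) : UnitAddCircle) (1 + 2 * s) else 0)‖ +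
      ‖2 * (-I * constIntegral s) * ((z.im : ℝ) : ℂ) ^ (-2 * s) *
        hurwitzZetaOdd (((v₀ 0 : ℝ) / (M : ℝ) : ℝ) : UnitAddCircle) (2 * s)‖ +
      ‖∑' u : ℤ, congrColumn M v₀ z s u‖ ≤ C₂ * P₂ := by
    have t1 : 2 * Z₁ ≤ 2 * Z₁ * P₂ := le_mul_of_one_le_right (by positivity) hP₂1
    have t2 : 2 * I₂ * Z₂ * (z.im ^ (-2 * a) + z.im ^ (-2 * b)) ≤ 2 * I₂ * Z₂ * (P₂ + P₂) :=
      mul_le_mul_of_nonneg_left (add_le_add he1 he2) (by positivity)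
    have t3 : Kb * ((M : ℝ) ^ (2 + 2 * a) * Sa * z.im ^ (-2 - 2 * a) +
        (M : ℝ) ^ (2 + 2 * b) * Sb * z.im ^ (-2 - 2 * b)) ≤
        Kb * ((M : ℝ) ^ (2 + 2 * a) * Sa * P₂ + (M : ℝ) ^ (2 + 2 * b) * Sb * P₂) :=
      mul_le_mul_of_nonneg_left (add_le_add (mul_le_mul_of_nonneg_left he3 (by positivity))
        (mul_le_mul_of_nonneg_left he4 (by positivity))) hKb0
    have h := add_le_add (add_le_add hZn hAn) hCn
    refine h.trans ?_
    rw [hC₂]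
    linarith [t1, t2, t3]
  -- `y^σ ≤ y^{A₁} + y^{-A₁}`
  have hσ : z.im ^ s.re ≤ z.im ^ A₁ + z.im ^ (-A₁) :=
    rpow_le_rpow_add_rpow_neg hy (abs_le.mpr ⟨by rw [hA₁]; linarith [abs_nonneg b, neg_abs_le a],
      by rw [hA₁]; linarith [abs_nonneg a, le_abs_self b]⟩)
  have hP₁0 : 0 ≤ z.im ^ A₁ + z.im ^ (-A₁) := by positivity
  -- assemble
  unfold congrCont
  rw [norm_mul, norm_mul, hn1]
  have hnorm3 : ‖(if (M : ℤ) ∣ v₀ 0 then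
        2 * hurwitzZetaOdd (((v₀ 1 : ℝ) / (M : ℝ) : ℝ) : UnitAddCircle) (1 + 2 * s) else 0) +
      2 * (-I * constIntegral s) * ((z.im : ℝ) : ℂ) ^ (-2 * s) *
        hurwitzZetaOdd (((v₀ 0 : ℝ) / (M : ℝ) : ℝ) : UnitAddCircle) (2 * s) +
      ∑' u : ℤ, congrColumn M v₀ z s u‖ ≤ C₂ * P₂ := by
    refine le_trans ?_ hbracket
    exact (norm_add_le _ _).trans (add_le_add (norm_add_le _ _) le_rfl)
  calc z.im ^ s.re * ‖(M : ℂ) ^ (-1 - 2 * s)‖ * ‖(if (M : ℤ) ∣ v₀ 0 then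
        2 * hurwitzZetaOdd (((v₀ 1 : ℝ) / (M : ℝ) : ℝ) : UnitAddCircle) (1 + 2 * s) else 0) +
      2 * (-I * constIntegral s) * ((z.im : ℝ) : ℂ) ^ (-2 * s) *
        hurwitzZetaOdd (((v₀ 0 : ℝ) / (M : ℝ) : ℝ) : UnitAddCircle) (2 * s) +
      ∑' u : ℤ, congrColumn M v₀ z s u‖
      ≤ (z.im ^ A₁ + z.im ^ (-A₁)) * (M : ℝ) ^ (-1 - 2 * a) * (C₂ * P₂) :=
        mul_le_mul (mul_le_mul hσ hn2 (norm_nonneg _) hP₁0) hnorm3 (norm_nonneg _) (by positivity)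
    _ = (M : ℝ) ^ (-1 - 2 * a) * C₂ * ((z.im ^ A₁ + z.im ^ (-A₁)) * P₂) := by ring
    _ ≤ (M : ℝ) ^ (-1 - 2 * a) * C₂ * (4 * (z.im ^ (A₁ + A₂) + z.im ^ (-(A₁ + A₂)))) :=
        mul_le_mul_of_nonneg_left (rpow_add_mul_rpow_add_le hy hA₁0 hA₂0) (by positivity)
    _ = (M : ℝ) ^ (-1 - 2 * a) * C₂ * 4 * (z.im ^ (A₁ + A₂) + z.im ^ (-(A₁ + A₂))) := by ring

end Bounds

end Literature.NumberTheory.EllipticCurves.ModularForms
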